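import Literature.AlgebraicGeometry.HodgeTheory.SupportedClassesAdditivity
import HarnessLib

/-!
# `Nˡ H²ˡ(X(ℂ); ℂ)` is generated by the classes supported on IRREDUCIBLE subvarieties of codimension `l`; the moving hypothesis of `AlgebraicClassesCup` for irreducible supports only (proved)

Family `hodge`, layer `Literature/AlgebraicGeometry/HodgeTheory`. Consequence of the additivity
`ker (H²ˡ(X) → H²ˡ(X ∖ (Z₁ ∪ Z₂))) ≤ ker (… ∖ Z₁) + ker (… ∖ Z₂)` for `codim (Z₁ ∩ Z₂) ≥ l + 1`
(`SupportedClassesAdditivity.ker_restrictCompl_union_le`, Mayer–Vietoris with supports +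
semipurity) for the coniveau carrier `algebraicClasses X l = supportedClasses X (2l) l = Nˡ H²ˡ`
(`HodgeTheory/AlgebraicClasses`) of a smooth projective `X/ℂ`:

* `ker_restrictCompl_sUnion_le_iSup`, `ker_restrictCompl_le_iSup_isIrreducible`,
  `supportedClasses_eq_iSup_isIrreducible`, `algebraicClasses_eq_iSup_isIrreducible` — **`Nˡ H²ˡ` is
  the sum, over the IRREDUCIBLE Zariski-closed `V ⊆ X` all of whose points have codimension `≥ l`,
  of `ker (H²ˡ(X(ℂ)) → H²ˡ((X ∖ V)(ℂ)))`**: decompose a closed `Z` of codimension `≥ l` into its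
  finitely many irreducible components (`X` is Noetherian); for a component `V` not contained in
  the union `U` of the others, a point of `V ∩ U` other than the generic point of `V` is a strict
  specialisation of it (else `V ⊆` a component of `U`), hence of codimension `≥ l + 1`
  (Hartshorne II Ex. 3.20), and `2l + 1 < 2(l + 1)`. This is the support half of the purity
  statement `ker (H²ˡ(X) → H²ˡ(X ∖ Z)) = ⊕ⱼ ℂ · cl(Zⱼ)` (Fulton 1998, §19.1 Lemma 19.1.1: "`H_{2k}`
  of a `k`-dimensional scheme is free on its `k`-dimensional components") — the reduction to one
  irreducible subvariety at a time, with no cycle class needed.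
* `algebraicClasses_eq_iSup_coheight_genericPoint_eq` — only the components of codimension EXACTLY
  `l` (generic point of codimension `l`, the prime cycles of codimension `l`) contribute, the
  others carrying no class of degree `2l` (semipurity).
* `cupProduct_mem_algebraicClasses_of_moving_isIrreducible` — consequently the MOVING hypothesis of
  `cupProduct_mem_algebraicClasses_of_moving` (`AlgebraicClassesCup`, the reduction of Voisin II
  Prop. 9.20 `Nˡ ∪ Nᵏ ⊆ N^{l+k}` to its algebro-geometric input) need only be supplied for an
  IRREDUCIBLE closed `Z` (codimension `≥ l`) against an IRREDUCIBLE closed `W` (codimension `≥ k`)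
  — the printed setting of Chow's moving lemma (a prime cycle and a subvariety; Fulton §11.4,
  Voisin II Lemma 9.22). The input itself is NOT here (D-0026: to be constructed).

Everything is proved; no definitions, no named facts.

## References

* [Fulton1998] W. Fulton, Intersection Theory, 2nd ed. 1998, §19.1 Lemma 19.1.1, §11.4.
* [GrothendieckTopology1969] A. Grothendieck, Hodge's general conjecture is false for trivial
  reasons, Topology 8 (1969), §1.
* [VoisinHodgeII2003] C. Voisin, Hodge Theory and Complex Algebraic Geometry II, CUP 2003, §9.2.4
  Prop. 9.20, Lemma 9.22.
* [Hartshorne1977] R. Hartshorne, Algebraic Geometry, II Ex. 3.20, I Prop. 1.5.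
-/

noncomputable section

open CategoryTheory AlgebraicGeometry Set TopologicalSpace
open Literature.AlgebraicTopology.SingularHomology

namespace Literature.AlgebraicGeometry.HodgeTheory

section HodgeTheory

variable {n : ℕ} {X : Motives.SchemeOver ℂ}

/-! ### `Nˡ H²ˡ` is generated by classes supported on irreducible subvarieties -/

/-- The total space of a smooth projective variety is a Noetherian topological space (finite type
over a field). Local copy of `noetherianSpace_of_isSmoothProjective` (file
`CorrespondenceSupportedVanishing`, not imported to keep the closure small).
[cite: Hartshorne1977, II Prop. 3.2 and II Ex. 2.13] -/
private theorem noetherianSpace_of_isSmoothProjective'' (hX : Motives.IsSmoothProjective n X) :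
    TopologicalSpace.NoetherianSpace ↥X.left := by
  haveI := Motives.IsSmoothProjective.isLocallyNoetherian_holds hX
  haveI := Motives.IsSmoothProjective.compactSpace_holds hX
  haveI : IsNoetherian X.left := {}
  infer_instance

/-- Strict specialisation raises the codimension: `g ⤳ x`, `g ≠ x`, `codim g ≥ l` ⟹
`codim x ≥ l + 1`. Local copy of `add_one_le_coheight_of_specializes` (file
`AlgebraicClassesCupAbelianVariety`, not imported to keep abelian varieties out of the closure).
[cite: Hartshorne1977, II Ex. 3.20] -/
private theorem add_one_le_coheight_of_specializes'' {g x : X.left} (h : g ⤳ x) (hne : g ≠ x)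
    {l : ℕ} (hl : (l : ℕ∞) ≤ Order.coheight g) : ((l + 1 : ℕ) : ℕ∞) ≤ Order.coheight x := by
  have hlt : x < g := by
    refine lt_of_le_not_ge (Scheme.le_iff_specializes.2 h) fun h' ↦ hne ?_
    exact (h.antisymm (Scheme.le_iff_specializes.1 h')).eq
  calc ((l + 1 : ℕ) : ℕ∞) = (l : ℕ∞) + 1 := by push_cast; rfl
    _ ≤ Order.coheight g + 1 := add_le_add hl le_rfl
    _ ≤ Order.coheight x := Order.coheight_add_one_le hlt

/-- **Finite unions of irreducible closed subsets: the kernel splits** (induction on the number of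
pieces). For finitely many irreducible Zariski-closed `Vⱼ ⊆ X` with all points of codimension `≥ l`,
`ker (H²ˡ(X(ℂ)) → H²ˡ((X ∖ ⋃ Vⱼ)(ℂ))) ≤ Σ_V ker (H²ˡ(X(ℂ)) → H²ˡ((X ∖ V)(ℂ)))`, `V` over the
irreducible closed subsets of codimension `≥ l`. Step: either `V₀ ⊆ ⋃_{j>0} Vⱼ` (drop it), or every
point of `V₀ ∩ ⋃_{j>0} Vⱼ` differs from the generic point of `V₀` (else `V₀ ⊆ Vⱼ`), hence is a strict
specialisation of it, of codimension `≥ l + 1`, and `ker_restrictCompl_union_le` applies with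
`2l + 1 < 2(l + 1)`. [cite: GrothendieckTopology1969, §1] [cite: Hartshorne1977, II Ex. 3.20 and I Prop. 1.5] -/
theorem ker_restrictCompl_sUnion_le_iSup (hX : Motives.IsSmoothProjective n X) {l : ℕ}
    (S : Finset (Set X.left)) (hSc : ∀ t ∈ S, IsClosed t) (hSi : ∀ t ∈ S, IsIrreducible t)
    (hSl : ∀ t ∈ S, ∀ z ∈ t, (l : ℕ∞) ≤ Order.coheight z) :
    LinearMap.ker (complexBetti.restrictCompl X (⋃₀ (↑S : Set (Set X.left))) (2 * l)).hom ≤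
      ⨆ (V : Set X.left) (_ : IsClosed V) (_ : IsIrreducible V)
        (_ : ∀ v ∈ V, (l : ℕ∞) ≤ Order.coheight v),
        LinearMap.ker (complexBetti.restrictCompl X V (2 * l)).hom := by
  classical
  induction S using Finset.induction_on with
  | empty =>
    intro a ha
    have ha' : complexBetti.restrictCompl X (⋃₀ (↑(∅ : Finset (Set X.left)) : Set (Set X.left)))
        (2 * l) a = 0 := ha
    rw [Finset.coe_empty, Set.sUnion_empty] at ha'
    have hinj := injective_restrictCompl_of_le_coheight hX isClosed_empty (c := l + 1)
      (fun z hz ↦ (Set.notMem_empty z hz).elim) (i := 2 * l) (by omega)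
    have h0 : a = 0 := hinj (by rw [ha', map_zero])
    rw [h0]
    exact Submodule.zero_mem _
  | insert V S hVS ih =>
    have hVc : IsClosed V := hSc V (Finset.mem_insert_self V S)
    have hVi : IsIrreducible V := hSi V (Finset.mem_insert_self V S)
    have hVl : ∀ z ∈ V, (l : ℕ∞) ≤ Order.coheight z := hSl V (Finset.mem_insert_self V S)
    have ih' := ih (fun t ht ↦ hSc t (Finset.mem_insert_of_mem ht))
      (fun t ht ↦ hSi t (Finset.mem_insert_of_mem ht)) (fun t ht ↦ hSl t (Finset.mem_insert_of_mem ht))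
    have hU : IsClosed (⋃₀ (↑S : Set (Set X.left))) := by
      rw [Set.sUnion_eq_biUnion]
      exact S.finite_toSet.isClosed_biUnion fun t ht ↦ hSc t (Finset.mem_insert_of_mem ht)
    rw [Finset.coe_insert, Set.sUnion_insert]
    by_cases hsub : V ⊆ ⋃₀ (↑S : Set (Set X.left))
    · rw [Set.union_eq_self_of_subset_left hsub]
      exact ih'
    · have hint : ∀ t ∈ V ∩ ⋃₀ (↑S : Set (Set X.left)), ((l + 1 : ℕ) : ℕ∞) ≤ Order.coheight t := by
        rintro x ⟨hxV, hxU⟩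
        obtain ⟨t, ht, hxt⟩ := Set.mem_sUnion.1 hxU
        have hη := hVi.isGenericPoint_genericPoint hVc
        refine add_one_le_coheight_of_specializes'' (hη.specializes hxV) (fun heq ↦ hsub ?_)
          (hVl _ hη.mem)
        have hηt : hVi.genericPoint ∈ t := by rw [heq]; exact hxt
        exact ((hη.mem_closed_set_iff (hSc t (Finset.mem_insert_of_mem ht))).1 hηt).trans
          (Set.subset_sUnion_of_mem ht)
      calc LinearMap.ker (complexBetti.restrictCompl X (V ∪ ⋃₀ (↑S : Set (Set X.left))) (2 * l)).hom
          ≤ LinearMap.ker (complexBetti.restrictCompl X V (2 * l)).hom ⊔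
              LinearMap.ker (complexBetti.restrictCompl X (⋃₀ (↑S : Set (Set X.left))) (2 * l)).hom :=
            ker_restrictCompl_union_le hX hVc hU hint (by omega)
        _ ≤ _ := sup_le (le_iSup_of_le V (le_iSup_of_le hVc (le_iSup_of_le hVi
            (le_iSup (fun _ : (∀ v ∈ V, (l : ℕ∞) ≤ Order.coheight v) ↦
              LinearMap.ker (complexBetti.restrictCompl X V (2 * l)).hom) hVl)))) ih'

/-- **Classes supported in codimension `≥ l` in degree `2l` are sums of classes each supported on
ONE IRREDUCIBLE closed subvariety of codimension `≥ l`** (the support half of purity, Fulton 1998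
§19.1 Lemma 19.1.1 "`H_{2k}` of a `k`-dimensional scheme is free on its `k`-dimensional irreducible
components", on the tree's carrier): for `Z ⊆ X` Zariski-closed with every point of codimension
`≥ l`, `ker (H²ˡ(X(ℂ)) → H²ˡ((X ∖ Z)(ℂ))) ≤ Σ_V ker (H²ˡ(X(ℂ)) → H²ˡ((X ∖ V)(ℂ)))`, `V` ranging over
the irreducible Zariski-closed subsets of `X` all of whose points have codimension `≥ l` — decompose
`Z` into its finitely many irreducible components (`X` is Noetherian) and apply
`ker_restrictCompl_sUnion_le_iSup`. [cite: Fulton1998, §19.1 Lemma 19.1.1]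
[cite: GrothendieckTopology1969, §1] -/
theorem ker_restrictCompl_le_iSup_isIrreducible (hX : Motives.IsSmoothProjective n X) {l : ℕ}
    {Z : Set X.left} (hZ : IsClosed Z) (hcZ : ∀ z ∈ Z, (l : ℕ∞) ≤ Order.coheight z) :
    LinearMap.ker (complexBetti.restrictCompl X Z (2 * l)).hom ≤
      ⨆ (V : Set X.left) (_ : IsClosed V) (_ : IsIrreducible V)
        (_ : ∀ v ∈ V, (l : ℕ∞) ≤ Order.coheight v),
        LinearMap.ker (complexBetti.restrictCompl X V (2 * l)).hom := by
  haveI := noetherianSpace_of_isSmoothProjective'' hX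
  obtain ⟨S, hSf, hSc, hSi, hZS⟩ := NoetherianSpace.exists_finite_set_isClosed_irreducible hZ
  lift S to Finset (Set X.left) using hSf
  have hSl : ∀ t ∈ S, ∀ z ∈ t, (l : ℕ∞) ≤ Order.coheight z := fun t ht z hz ↦
    hcZ z (by rw [hZS]; exact Set.mem_sUnion_of_mem hz (Finset.mem_coe.2 ht))
  subst hZS
  exact ker_restrictCompl_sUnion_le_iSup hX S (fun t ht ↦ hSc t (Finset.mem_coe.2 ht))
    (fun t ht ↦ hSi t (Finset.mem_coe.2 ht)) hSl

/-- **`Nˡ H²ˡ(X(ℂ); ℂ)` is the sum over the IRREDUCIBLE closed subvarieties `V ⊆ X` of codimension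
`≥ l` of the classes dying off `V`** (Grothendieck's coniveau `Nˡ H²ˡ` needs only irreducible
supports; Fulton 1998 §19.1 Lemma 19.1.1 in support form). For `X` smooth projective over `ℂ`.
[cite: GrothendieckTopology1969, §1] [cite: Fulton1998, §19.1 Lemma 19.1.1] -/
theorem supportedClasses_eq_iSup_isIrreducible (hX : Motives.IsSmoothProjective n X) (l : ℕ) :
    supportedClasses X (2 * l) l =
      ⨆ (V : Set X.left) (_ : IsClosed V) (_ : IsIrreducible V)
        (_ : ∀ v ∈ V, (l : ℕ∞) ≤ Order.coheight v),
        LinearMap.ker (complexBetti.restrictCompl X V (2 * l)).hom := by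
  refine le_antisymm (supportedClasses_le fun Z hZ hcZ ↦ ker_restrictCompl_le_iSup_isIrreducible hX hZ hcZ) ?_
  exact iSup_le fun V ↦ iSup_le fun hVc ↦ iSup_le fun _ ↦ iSup_le fun hVl ↦
    le_iSup_of_le V (le_iSup_of_le hVc (le_iSup_of_le hVl le_rfl))

/-- **The space of algebraic classes of codimension `p` is generated by the classes supported on
single irreducible closed subvarieties of codimension `≥ p`**: `algebraicClasses X p = Σ_V ker
(H²ᵖ(X(ℂ)) → H²ᵖ((X ∖ V)(ℂ)))`, `V` irreducible Zariski-closed with every point of codimension `≥ p`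
(for `X` smooth projective; in print `= Σ_V ℂ · cl(V)` over the irreducible `V` of codimension
exactly `p`, Fulton 1998 §19.1). [cite: Fulton1998, §19.1 Lemma 19.1.1] [cite: Deligne2000, §1] -/
theorem algebraicClasses_eq_iSup_isIrreducible (hX : Motives.IsSmoothProjective n X) (p : ℕ) :
    algebraicClasses X p =
      ⨆ (V : Set X.left) (_ : IsClosed V) (_ : IsIrreducible V)
        (_ : ∀ v ∈ V, (p : ℕ∞) ≤ Order.coheight v),
        LinearMap.ker (complexBetti.restrictCompl X V (2 * p)).hom :=
  supportedClasses_eq_iSup_isIrreducible hX p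

/-- **Only the irreducible components of codimension EXACTLY `p` contribute**: in
`algebraicClasses_eq_iSup_isIrreducible` one may restrict to the irreducible closed `V` whose generic
point has codimension `p` (the prime cycles of codimension `p`); an irreducible `V` whose generic
point has codimension `≥ p + 1` has all its points of codimension `≥ p + 1` (codimension does not
drop under specialisation) and carries no non-zero class of degree `2p` (semipurity,
`injective_restrictCompl_of_le_coheight`). In print: `Nᵖ H²ᵖ = Σ_V ℂ · cl(V)` over the irreducible
`V` of codimension `p` (Fulton 1998 §19.1). [cite: Fulton1998, §19.1 Lemma 19.1.1]
[cite: GrothendieckTopology1969, §1] -/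
theorem algebraicClasses_eq_iSup_coheight_genericPoint_eq (hX : Motives.IsSmoothProjective n X) (p : ℕ) :
    algebraicClasses X p =
      ⨆ (V : Set X.left) (_ : IsClosed V) (hV : IsIrreducible V)
        (_ : ∀ v ∈ V, (p : ℕ∞) ≤ Order.coheight v) (_ : Order.coheight hV.genericPoint = p),
        LinearMap.ker (complexBetti.restrictCompl X V (2 * p)).hom := by
  rw [algebraicClasses_eq_iSup_isIrreducible hX p]
  refine le_antisymm ?_ ?_
  · refine iSup_le fun V ↦ iSup_le fun hVc ↦ iSup_le fun hVi ↦ iSup_le fun hVl ↦ ?_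
    by_cases hη : Order.coheight hVi.genericPoint = p
    · exact le_iSup_of_le V (le_iSup_of_le hVc (le_iSup_of_le hVi (le_iSup_of_le hVl
        (le_iSup (fun _ : Order.coheight hVi.genericPoint = (p : ℕ∞) ↦
          LinearMap.ker (complexBetti.restrictCompl X V (2 * p)).hom) hη))))
    · -- every point of `V` has codimension `≥ p + 1`: the kernel vanishes
      have hgen := hVi.isGenericPoint_genericPoint hVc
      have hη' : ((p + 1 : ℕ) : ℕ∞) ≤ Order.coheight hVi.genericPoint := by
        have hlt : (p : ℕ∞) < Order.coheight hVi.genericPoint :=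
          lt_of_le_of_ne (hVl _ hgen.mem) (Ne.symm hη)
        have h1 : ((p + 1 : ℕ) : ℕ∞) = (p : ℕ∞) + 1 := by push_cast; rfl
        rw [h1]
        exact Order.add_one_le_of_lt hlt
      have hVl' : ∀ v ∈ V, ((p + 1 : ℕ) : ℕ∞) ≤ Order.coheight v := fun v hv ↦
        hη'.trans (Order.coheight_anti (Scheme.le_iff_specializes.2 (hgen.specializes hv)))
      have hinj := injective_restrictCompl_of_le_coheight hX hVc hVl' (i := 2 * p) (by omega)
      intro a ha
      have h0 : a = 0 := hinj (by rw [LinearMap.mem_ker.1 ha, map_zero])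
      rw [h0]
      exact Submodule.zero_mem _
  · exact iSup_le fun V ↦ iSup_le fun hVc ↦ iSup_le fun hVi ↦ iSup_le fun hVl ↦ iSup_le fun _ ↦
      le_iSup_of_le V (le_iSup_of_le hVc (le_iSup_of_le hVi
        (le_iSup (fun _ : (∀ v ∈ V, (p : ℕ∞) ≤ Order.coheight v) ↦
          LinearMap.ker (complexBetti.restrictCompl X V (2 * p)).hom) hVl)))

/-! ### The moving hypothesis needs only irreducible supports -/

/-- **Products of algebraic classes are algebraic as soon as IRREDUCIBLE supports can be moved**
(sharpening of `cupProduct_mem_algebraicClasses_of_moving`, `AlgebraicClassesCup`, by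
`algebraicClasses_eq_iSup_isIrreducible`): for `X` smooth projective over `ℂ` it suffices, in the
moving hypothesis, to move classes dying off an IRREDUCIBLE closed `Z` (codimension `≥ l`) with
respect to an IRREDUCIBLE closed `W` (codimension `≥ k`) — the printed setting of Chow's moving
lemma for a prime cycle and a subvariety (Fulton 1998 §11.4; Voisin II Lemma 9.22).
[cite: VoisinHodgeII2003, §9.2.4 Prop. 9.20 and Lemma 9.22] [cite: Fulton1998, §11.4 Moving Lemma] -/
theorem cupProduct_mem_algebraicClasses_of_moving_isIrreducible (hX : Motives.IsSmoothProjective n X)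
    {l k : ℕ}
    (hmove : ∀ ⦃Z W : Set X.left⦄, IsClosed Z → IsIrreducible Z →
      (∀ z ∈ Z, (l : ℕ∞) ≤ Order.coheight z) → IsClosed W → IsIrreducible W →
        (∀ w ∈ W, (k : ℕ∞) ≤ Order.coheight w) →
        LinearMap.ker (complexBetti.restrictCompl X Z (2 * l)).hom ≤
          ⨆ (T : Set X.left) (_ : IsClosed T)
            (_ : ∀ t ∈ T ∩ W, ((l + k : ℕ) : ℕ∞) ≤ Order.coheight t),
            LinearMap.ker (complexBetti.restrictCompl X T (2 * l)).hom)
    {a : complexBetti X (2 * l)} {b : complexBetti X (2 * k)} (ha : a ∈ algebraicClasses X l)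
    (hb : b ∈ algebraicClasses X k) :
    cupProduct (two_mul_add_two_mul l k) a b ∈ algebraicClasses X (l + k) := by
  -- (A) for `b` killed off an irreducible closed `W` of codimension `≥ k`, every algebraic `a` works
  have hA : ∀ ⦃W : Set X.left⦄, IsClosed W → IsIrreducible W →
      (∀ w ∈ W, (k : ℕ∞) ≤ Order.coheight w) →
      ∀ ⦃b : complexBetti X (2 * k)⦄, complexBetti.restrictCompl X W (2 * k) b = 0 →
        algebraicClasses X l ≤ (algebraicClasses X (l + k)).comap
          ((cupProduct (two_mul_add_two_mul l k)).flip b) := by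
    intro W hW hWi hWk b hb
    rw [algebraicClasses_eq_iSup_isIrreducible hX l]
    refine iSup_le fun Z ↦ iSup_le fun hZ ↦ iSup_le fun hZi ↦ iSup_le fun hZl ↦
      (hmove hZ hZi hZl hW hWi hWk).trans ?_
    refine iSup_le fun T ↦ iSup_le fun hT ↦ iSup_le fun hTW ↦ ?_
    intro a ha
    rw [Submodule.mem_comap, LinearMap.flip_apply]
    exact cupProduct_mem_supportedClasses_of_inter hT hW hTW _ (LinearMap.mem_ker.mp ha) hb
  -- (B) then every algebraic `b` works
  have hB : algebraicClasses X k ≤ (algebraicClasses X (l + k)).comap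
      (cupProduct (two_mul_add_two_mul l k) a) := by
    rw [algebraicClasses_eq_iSup_isIrreducible hX k]
    refine iSup_le fun W ↦ iSup_le fun hW ↦ iSup_le fun hWi ↦ iSup_le fun hWk ↦ ?_
    intro b hb
    have hab := hA hW hWi hWk (LinearMap.mem_ker.mp hb) ha
    rw [Submodule.mem_comap, LinearMap.flip_apply] at hab
    rw [Submodule.mem_comap]
    exact hab
  exact Submodule.mem_comap.mp (hB hb)

end HodgeTheory

end Literature.AlgebraicGeometry.HodgeTheory

end
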